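import Summits.QuantumFields.YangMills.Theorems.ColdStartUniversalityLatticeLangevinDossSussmannFlow
import Literature.MathematicalPhysics.QuantumLattice.SU2Haar
import Literature.Analysis.FluidPDE.TaoAveragedQuaternionRotation
import HarnessLib

/-!
# Route `ColdStartUniversality` (fixed-cut-off SZZ dynamics; Doss–Sussmann smoothing programme, file 3):
# A SMOOTH RETRACTION OF A NEIGHBOURHOOD OF `SU(2)^E` ONTO `SU(2)^E` (ambient matrix coordinates) AND A CUT-OFF

Helper file (seat `ym-line-csu-p1`, g24).  To differentiate `x ↦ 𝔼 F(U^x_t)` along the AMBIENT configuration space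
(the tree's cylinder functions are restrictions of ambient `C^k` functions) while only ever evaluating the SZZ dynamics at
GROUP points, one composes with a retraction.  Per link we use the quaternion model of the tree's `SU2Haar.lean`
(`quatToSU2 ∘ π`, `π(M) = (Re M₀₀, Im M₀₀, Re M₀₁, Im M₀₁) ∈ ℍ`, radial projection to unit quaternions):
* `contDiffOn_quatMatrix_normalize` — the entries of `quatMatrix(q/‖q‖)` are `C^∞` on `q ≠ 0`;
* ★ `exists_smooth_retraction` — a map `R : Cfg → SU(2)^E` on the ambient configuration space
  `Cfg = Edge → (Fin 2 → Fin 2 → ℂ)` with `R(coords x) = x` for every `x ∈ SU(2)^E`, whose matrix coordinates are `C^∞` on an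
  OPEN set `U₀ ⊇ coords(SU(2)^E)`, together with a `C^∞` cut-off `χ : Cfg → ℝ`, `χ(coords x) = 1` on the group and `χ = 0`
  near every point outside `U₀`;
* `contDiff_mul_of_eventuallyEq_zero` — gluing: `χ · h` is `C^n` on all of `Cfg` as soon as `h` is `C^n` on `U₀`.
THEOREMS ONLY, no sorry.  HONEST FRAMING: fixed-cut-off plumbing; nothing K-uniform; no crux, rung or summit statement is
proved; the Yang–Mills mass gap is NOT proved.
-/

set_option autoImplicit false

noncomputable section

namespace Summit.QuantumFields.YangMills.Theorems.ColdStartUniversality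

open MeasureTheory Finset Filter Set Metric Function Quaternion
open scoped NNReal Matrix ComplexConjugate Topology Quaternion
open Literature.MathematicalPhysics.QuantumFieldTheory
open Literature.Analysis.FluidPDE.Tao2016 (contDiff_quat_re contDiff_quat_imI contDiff_quat_imJ contDiff_quat_imK)
open Literature.MathematicalPhysics.QuantumLattice (fundamentalRep fundamentalLatticeRep continuous_fundamentalRep
  fundamentalRep_mem_unitaryGroup quatMatrix su2Quat quatToSU2 coe_quatToSU2 quatToSU2_su2Quat su2Quat_ne_zero
  norm_su2Quat)

variable {L : ℕ}

/-! ## Smoothness of the normalised quaternion matrix -/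

/-- A complex number built from two `C^n` real functions is `C^n`. [folklore] -/
theorem contDiff_complex_mk {E : Type*} [NormedAddCommGroup E] [NormedSpace ℝ E] {n : WithTop ℕ∞}
    {a b : E → ℝ} (ha : ContDiff ℝ n a) (hb : ContDiff ℝ n b) :
    ContDiff ℝ n fun x => (⟨a x, b x⟩ : ℂ) :=
  Complex.equivRealProdCLM.symm.contDiff.comp (ha.prodMk hb)

/-- The entries of `quatMatrix q` are `C^∞` in `q`. [folklore] -/
theorem contDiff_quatMatrix_entry {n : WithTop ℕ∞} (k l : Fin 2) : ContDiff ℝ n fun q : ℍ => quatMatrix q k l := by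
  fin_cases k <;> fin_cases l
  · simpa using contDiff_complex_mk (n := n) contDiff_quat_re contDiff_quat_imI
  · simpa using contDiff_complex_mk (n := n) contDiff_quat_imJ contDiff_quat_imK
  · simpa using contDiff_complex_mk (n := n) contDiff_quat_imJ.neg contDiff_quat_imK
  · simpa using contDiff_complex_mk (n := n) contDiff_quat_re contDiff_quat_imI.neg

/-- ★ The entries of the normalised quaternion matrix `quatMatrix(‖q‖⁻¹ q)` — the matrix of the radial projection
`quatToSU2` — are `C^∞` on `q ≠ 0`. [folklore] -/
theorem contDiffOn_quatMatrix_normalize {n : WithTop ℕ∞} (k l : Fin 2) :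
    ContDiffOn ℝ n (fun q : ℍ => quatMatrix (‖q‖⁻¹ • q) k l) {0}ᶜ := by
  intro q hq
  have hq0 : (q : ℍ) ≠ (0 : ℍ) := hq
  have hn : ContDiffAt ℝ n (fun q : ℍ => ‖q‖) q := contDiffAt_norm (E := ℍ) ℝ hq0
  have hi : ContDiffAt ℝ n (fun q : ℍ => ‖q‖⁻¹) q := hn.inv (norm_ne_zero_iff.2 hq0)
  have h1 : ContDiffAt ℝ n (fun q : ℍ => ‖q‖⁻¹ • q) q :=
    hi.smul (contDiffAt_id : ContDiffAt ℝ n (fun q : ℍ => q) q)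
  exact ((contDiff_quatMatrix_entry k l).contDiffAt.comp q h1).contDiffWithinAt

/-! ## The linkwise quaternion `π_e(M) = (Re M_e00, Im M_e00, Re M_e01, Im M_e01)` and the retraction -/

/-- The link quaternion is a real-linear, hence `C^∞`, function of the ambient configuration. [folklore] -/
theorem contDiff_linkQuat [NeZero L] {n : WithTop ℕ∞} (e : Edge 3 L) :
    @ContDiff ℝ _ (Edge 3 L → Fin 2 → Fin 2 → ℂ) _ _ ℍ _ _ n fun M =>
      (⟨(M e 0 0).re, (M e 0 0).im, (M e 0 1).re, (M e 0 1).im⟩ : ℍ) := by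
  let πl : (Edge 3 L → Fin 2 → Fin 2 → ℂ) →ₗ[ℝ] ℍ :=
    { toFun := fun M => ⟨(M e 0 0).re, (M e 0 0).im, (M e 0 1).re, (M e 0 1).im⟩
      map_add' := fun M M' => by ext <;> simp
      map_smul' := fun c M => by ext <;> simp }
  exact (LinearMap.toContinuousLinearMap πl).contDiff

/-- ★ **A smooth retraction of a neighbourhood of `SU(2)^E` onto `SU(2)^E`, and a cut-off.**  On the ambient configuration
space `Cfg = Edge → (Fin 2 → Fin 2 → ℂ)` there are a map `R : Cfg → SU(2)^E`, an open set `U₀` containing the matrix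
coordinates of every group configuration, and a `C^∞` function `χ : Cfg → ℝ` with: `R(coords x) = x` on the group;
the matrix coordinates of `R` are `C^∞` on `U₀`; `χ(coords x) = 1` on the group; `χ` vanishes identically near every
point outside `U₀` (construction: linkwise radial projection of the quaternion `(Re M₀₀, Im M₀₀, Re M₀₁, Im M₀₁)` onto
the unit quaternions, `quatToSU2` of `SU2Haar.lean`; `U₀` = all link quaternions non-zero; `χ` = product over links of
`smoothTransition(4‖q_e‖² − 1)`). [folklore] -/
theorem exists_smooth_retraction (L : ℕ) [NeZero L] :
    ∃ (R : (Edge 3 L → Fin 2 → Fin 2 → ℂ) → GaugeConfig 3 L (Matrix.specialUnitaryGroup (Fin 2) ℂ))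
      (U₀ : Set (Edge 3 L → Fin 2 → Fin 2 → ℂ)) (χ : (Edge 3 L → Fin 2 → Fin 2 → ℂ) → ℝ),
      IsOpen U₀ ∧
      (∀ x : GaugeConfig 3 L (Matrix.specialUnitaryGroup (Fin 2) ℂ),
        (fun (e : Edge 3 L) (k l : Fin 2) => (x e : Matrix (Fin 2) (Fin 2) ℂ) k l) ∈ U₀) ∧
      (∀ x : GaugeConfig 3 L (Matrix.specialUnitaryGroup (Fin 2) ℂ),
        R (fun (e : Edge 3 L) (k l : Fin 2) => (x e : Matrix (Fin 2) (Fin 2) ℂ) k l) = x) ∧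
      ContDiffOn ℝ (⊤ : ℕ∞) (fun M => fun (e : Edge 3 L) (k l : Fin 2) => (R M e : Matrix (Fin 2) (Fin 2) ℂ) k l) U₀ ∧
      ContDiff ℝ (⊤ : ℕ∞) χ ∧
      (∀ x : GaugeConfig 3 L (Matrix.specialUnitaryGroup (Fin 2) ℂ),
        χ (fun (e : Edge 3 L) (k l : Fin 2) => (x e : Matrix (Fin 2) (Fin 2) ℂ) k l) = 1) ∧
      (∀ M, M ∉ U₀ → χ =ᶠ[𝓝 M] fun _ => 0) := by
  -- the link quaternions, as an opaque function with its defining equation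
  obtain ⟨π, hπ⟩ : ∃ π : Edge 3 L → (Edge 3 L → Fin 2 → Fin 2 → ℂ) → ℍ,
      π = fun e M => ⟨(M e 0 0).re, (M e 0 0).im, (M e 0 1).re, (M e 0 1).im⟩ := ⟨_, rfl⟩
  obtain ⟨η, hη⟩ : ∃ η : ℝ → ℝ, η = fun s => Real.smoothTransition (4 * s - 1) := ⟨_, rfl⟩
  have hπs : ∀ e, ∀ {n : WithTop ℕ∞}, ContDiff ℝ n (π e) := fun e {n} => by
    rw [hπ]; exact contDiff_linkQuat (L := L) e
  have hπc : ∀ e, Continuous (π e) := fun e => (hπs e (n := 0)).continuous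
  have hπx : ∀ (x : GaugeConfig 3 L (Matrix.specialUnitaryGroup (Fin 2) ℂ)) (e : Edge 3 L),
      π e (fun (e : Edge 3 L) (k l : Fin 2) => (x e : Matrix (Fin 2) (Fin 2) ℂ) k l) = su2Quat (x e) := fun x e => by
    rw [hπ]; rfl
  have hηs : ∀ {n : ℕ∞}, ContDiff ℝ n η := fun {n} => by
    rw [hη]; exact Real.smoothTransition.contDiff.comp ((contDiff_const.mul contDiff_id).sub contDiff_const)
  have hU₀ : IsOpen {M : Edge 3 L → Fin 2 → Fin 2 → ℂ | ∀ e, π e M ≠ 0} := by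
    have : {M : Edge 3 L → Fin 2 → Fin 2 → ℂ | ∀ e, π e M ≠ 0} = ⋂ e, (π e) ⁻¹' {0}ᶜ := by ext M; simp
    rw [this]
    exact isOpen_iInter_of_finite fun e => (isOpen_compl_singleton).preimage (hπc e)
  refine ⟨fun M e => quatToSU2 (π e M), {M | ∀ e, π e M ≠ 0}, fun M => ∏ e, η (‖π e M‖ ^ 2), hU₀,
    ?_, ?_, ?_, ?_, ?_, ?_⟩
  · intro x e
    rw [hπx]
    exact su2Quat_ne_zero (x e)
  · intro x; funext e
    show quatToSU2 (π e _) = x e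
    rw [hπx, quatToSU2_su2Quat]
  · refine contDiffOn_pi.2 fun e => contDiffOn_pi.2 fun k => contDiffOn_pi.2 fun l => ?_
    have h1 : ContDiffOn ℝ (⊤ : ℕ∞) (fun M : Edge 3 L → Fin 2 → Fin 2 → ℂ => quatMatrix (‖π e M‖⁻¹ • π e M) k l)
        {M | ∀ e, π e M ≠ 0} :=
      (contDiffOn_quatMatrix_normalize k l).comp (hπs e).contDiffOn fun M hM => hM e
    refine h1.congr fun M hM => ?_
    show (quatToSU2 (π e M) : Matrix (Fin 2) (Fin 2) ℂ) k l = _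
    rw [coe_quatToSU2 (hM e)]
  · exact contDiff_prod (t := Finset.univ) (f := fun e M => η (‖π e M‖ ^ 2))
      fun e _ => (hηs (n := ⊤)).comp ((hπs e).norm_sq ℝ)
  · intro x
    refine Finset.prod_eq_one fun e _ => ?_
    rw [hπx, norm_su2Quat, hη]
    exact Real.smoothTransition.one_of_one_le (by norm_num)
  · intro M hM
    simp only [Set.mem_setOf_eq, not_forall, not_not] at hM
    obtain ⟨e₀, he₀⟩ := hM
    -- near `M` the link quaternion `π e₀` has norm `< 1/2`, so its factor vanishes
    have hlt : ∀ᶠ M' in 𝓝 M, ‖π e₀ M'‖ < 1 / 2 := by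
      have hc : ContinuousAt (fun M' => ‖π e₀ M'‖) M := ((hπc e₀).norm).continuousAt
      refine hc.eventually (gt_mem_nhds ?_)
      show ‖π e₀ M‖ < 1 / 2
      rw [he₀, norm_zero]; norm_num
    filter_upwards [hlt] with M' hM'
    refine Finset.prod_eq_zero (Finset.mem_univ e₀) ?_
    rw [hη]
    refine Real.smoothTransition.zero_of_nonpos ?_
    nlinarith [norm_nonneg (π e₀ M')]

/-! ## Gluing with the cut-off -/

/-- **Gluing lemma.**  If `h` is `C^n` on an open set `U₀` and the `C^n` function `χ` vanishes identically near every point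
outside `U₀`, then `χ · h` is `C^n` everywhere. [folklore] -/
theorem contDiff_mul_of_eventuallyEq_zero {X : Type*} [NormedAddCommGroup X] [NormedSpace ℝ X] {n : WithTop ℕ∞}
    {h χ : X → ℝ} {U₀ : Set X} (hU : IsOpen U₀) (hh : ContDiffOn ℝ n h U₀) (hχ : ContDiff ℝ n χ)
    (h0 : ∀ M, M ∉ U₀ → χ =ᶠ[𝓝 M] fun _ => 0) :
    ContDiff ℝ n fun M => χ M * h M := by
  refine contDiff_iff_contDiffAt.2 fun M => ?_
  by_cases hM : M ∈ U₀
  · exact hχ.contDiffAt.mul (hh.contDiffAt (hU.mem_nhds hM))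
  · have hz : (fun M => χ M * h M) =ᶠ[𝓝 M] fun _ => 0 := by
      filter_upwards [h0 M hM] with M' hM'
      simp [hM']
    exact (contDiffAt_const (c := (0 : ℝ))).congr_of_eventuallyEq hz

end Summit.QuantumFields.YangMills.Theorems.ColdStartUniversality

end
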